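import Mathlib
import Literature.Analysis.FunctionSpaces.Mollification
import Literature.Analysis.FunctionSpaces.MollificationLp
import Literature.Analysis.FluidPDE.WeakGradientIBP
import Summits.NavierStokesRegularity.NavierStokesRegularity.Theorems.EulerZoomLiouvillePowerGaugeEulerLiouvilleWeakChainRuleTools
import HarnessLib

/-!
# Crux `EulerZoomLiouville.PowerGaugeEulerLiouville` (stmt-NavierStokesRegularity-19832), weak stratum, line `weak_axisym` (X1b) /
# `weak_eulerian` (E2): approximation tools for the DiPerna–Lions renormalisation

Route №10 `EulerZoomLiouville` (NavierStokesRegularity), crux E = stmt-NavierStokesRegularity-19832; width seat ns-ezl-w1 g9 under the LEAD ns-typeII-p2.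

* `abs_normed_convolution_le` — `|(φ̃ ⋆ g)(x)| ≤ C` when `|g| ≤ C` (unit-mass nonnegative kernel);
* `fderiv_normed_convolution_apply` — `D(φ̃ ⋆ θ)(x)[w] = (φ̃ ⋆ ∂_wθ)(x)` for `θ ∈ C¹_c`;
* `integral_fderiv_apply_eq_of_contDiff_one` — **the distributional divergence identity `div W = c` extends from smooth to `C¹` compactly supported
  tests** (`∫ Dθ[W] = −c∫θ`): mollify the test, pointwise convergence of `φ̃ₙ ⋆ θ`, `φ̃ₙ ⋆ ∂θ`, dominated convergence against `W ∈ L¹_loc`;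
* `tendsto_setLIntegral_mollify_sub_sq` — **local `L²` convergence of mollifications** `∫_{B_M}‖φ̃ₙ ⋆ g − g‖² → 0` for `g ∈ L²_loc`
  (the exponent-`2` twin of `WeakLagrangian.tendsto_setLIntegral_mollify_sub_rpow`).
[folklore; Evans2010 App. C.4 Thm. 7, §5.3.1]

WHAT THIS IS NOT: not NS, not E — approximation bookkeeping; 19832 is OPEN.
-/

noncomputable section

-- flat `Theorems/<Route><Decl>…` files of one crux share the namespace of the crux (tree convention)
set_option linter.dupNamespace false

open MeasureTheory Set Filter Topology Metric Function TopologicalSpace ContinuousLinearMap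
open scoped ENNReal NNReal RealInnerProductSpace ContDiff Convolution Pointwise

namespace Summit.NavierStokesRegularity.NavierStokesRegularity.Theorems.PowerGaugeEulerLiouville.WeakAxisym

open Literature.Analysis Literature.Analysis.FunctionSpaces Literature.Analysis.FluidPDE
open Summit.NavierStokesRegularity.NavierStokesRegularity.Theorems.PowerGaugeEulerLiouville

section Kernel

variable {F : Type*} [NormedAddCommGroup F] [NormedSpace ℝ F]

/-- `‖(φ̃ ⋆ g)(x)‖ ≤ C` if `‖g‖ ≤ C` everywhere and `g` is locally integrable (`φ̃ ≥ 0`, `∫ φ̃ = 1`). [folklore] -/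
theorem norm_normed_convolution_le (φ : ContDiffBump (0 : EuclideanSpace ℝ (Fin 3))) {g : EuclideanSpace ℝ (Fin 3) → F}
    {C : ℝ} (hC : ∀ x, ‖g x‖ ≤ C) (x : EuclideanSpace ℝ (Fin 3)) :
    ‖(φ.normed volume ⋆[lsmul ℝ ℝ, volume] g) x‖ ≤ C := by
  have hC0 : 0 ≤ C := (norm_nonneg _).trans (hC 0)
  rw [convolution_def]
  calc ‖∫ t, (lsmul ℝ ℝ) (φ.normed volume t) (g (x - t))‖ ≤ ∫ t, ‖(lsmul ℝ ℝ) (φ.normed volume t) (g (x - t))‖ :=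
        norm_integral_le_integral_norm _
    _ ≤ ∫ t, φ.normed volume t * C := by
        refine integral_mono_of_nonneg (Eventually.of_forall fun t => norm_nonneg _) (φ.integrable_normed.mul_const C)
          (Eventually.of_forall fun t => ?_)
        simp only [lsmul_apply, norm_smul, Real.norm_of_nonneg (φ.nonneg_normed t)]
        exact mul_le_mul_of_nonneg_left (hC _) (φ.nonneg_normed t)
    _ = C := by rw [integral_mul_const, φ.integral_normed, one_mul]

/-- `D(φ̃ ⋆ θ)(x)[w] = (φ̃ ⋆ (∂_w θ))(x)` for `θ ∈ C¹` with compact support. [folklore; Evans2010 App. C.4] -/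
theorem fderiv_normed_convolution_apply (φ : ContDiffBump (0 : EuclideanSpace ℝ (Fin 3))) {θ : EuclideanSpace ℝ (Fin 3) → F}
    (hθ : ContDiff ℝ 1 θ) (hθs : HasCompactSupport θ) (x w : EuclideanSpace ℝ (Fin 3)) :
    fderiv ℝ (φ.normed volume ⋆[lsmul ℝ ℝ, volume] θ) x w =
      (φ.normed volume ⋆[lsmul ℝ ℝ, volume] fun z => fderiv ℝ θ z w) x := by
  have hk : LocallyIntegrable (φ.normed volume) volume := φ.integrable_normed.locallyIntegrable
  have hD := hθs.hasFDerivAt_convolution_right (lsmul ℝ ℝ) hk hθ x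
  have hint : ConvolutionExistsAt (φ.normed volume) (fderiv ℝ θ) x
      ((lsmul ℝ ℝ : ℝ →L[ℝ] F →L[ℝ] F).precompR (EuclideanSpace ℝ (Fin 3))) volume :=
    (hθs.fderiv ℝ).convolutionExists_right _ hk (hθ.continuous_fderiv one_ne_zero) x
  rw [hD.fderiv, convolution_def, ContinuousLinearMap.integral_apply hint.integrable w, convolution_def]
  simp only [precompR_apply, compL_apply, ContinuousLinearMap.coe_comp, Function.comp_apply, lsmul_apply]

end Kernel

/-! ### The divergence identity extends to `C¹` compactly supported tests -/

section DivC1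

variable {W : EuclideanSpace ℝ (Fin 3) → EuclideanSpace ℝ (Fin 3)} {c : ℝ}

/-- **`∫ Dθ[W] = −c ∫ θ` for every `C¹` compactly supported `θ`**, given the identity `∫ ⟪W, ∇φ⟫ = −c∫φ` for smooth tests and `W ∈ L¹_loc`
(mollify `θ`; `φ̃ₙ ⋆ θ → θ`, `D(φ̃ₙ ⋆ θ)[W] = (φ̃ₙ ⋆ ∂_{W(y)}θ)(y) → Dθ[W]` pointwise, dominated by `sup‖Dθ‖·‖W‖` on a fixed compact).
[folklore; Evans2010 App. C.4 Thm. 7] -/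
theorem integral_fderiv_apply_eq_of_contDiff_one (hWl : LocallyIntegrable W volume)
    (hdiv : ∀ φ : EuclideanSpace ℝ (Fin 3) → ℝ, IsTestFunctionOn (⊤ : Opens (EuclideanSpace ℝ (Fin 3))) φ →
      ∫ y, ⟪W y, gradient φ y⟫ = -c * ∫ y, φ y)
    {θ : EuclideanSpace ℝ (Fin 3) → ℝ} (hθ : ContDiff ℝ 1 θ) (hθs : HasCompactSupport θ) :
    ∫ y, fderiv ℝ θ y (W y) = -c * ∫ y, θ y := by
  obtain ⟨φ, hφr, -⟩ := exists_contDiffBump_seq (E := EuclideanSpace ℝ (Fin 3))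
  have hk : ∀ n, LocallyIntegrable ((φ n).normed volume) volume := fun n => (φ n).integrable_normed.locallyIntegrable
  have hθc : Continuous θ := hθ.continuous
  have hDθc : Continuous (fderiv ℝ θ) := hθ.continuous_fderiv one_ne_zero
  have hθl : LocallyIntegrable θ volume := hθc.locallyIntegrable
  set θn : ℕ → EuclideanSpace ℝ (Fin 3) → ℝ := fun n => (φ n).normed volume ⋆[lsmul ℝ ℝ, volume] θ with hθn
  have hθn_s : ∀ n, ContDiff ℝ ∞ (θn n) := fun n =>
    (φ n).hasCompactSupport_normed.contDiff_convolution_left _ (φ n).contDiff_normed hθl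
  have hθn_cs : ∀ n, HasCompactSupport (θn n) := fun n => (φ n).hasCompactSupport_normed.convolution _ hθs
  have hθn_t : ∀ n, IsTestFunctionOn (⊤ : Opens (EuclideanSpace ℝ (Fin 3))) (θn n) := fun n => ⟨hθn_s n, hθn_cs n, by simp⟩
  -- the identity for the mollified tests
  have hid : ∀ n, ∫ y, fderiv ℝ (θn n) y (W y) = -c * ∫ y, θn n y := by
    intro n
    have h := hdiv (θn n) (hθn_t n)
    simp_rw [inner_gradient_eq_fderiv_apply] at h
    exact h
  -- ### a compact set carrying all supports (for `rOut ≤ 1`)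
  set K : Set (EuclideanSpace ℝ (Fin 3)) := closedBall (0 : EuclideanSpace ℝ (Fin 3)) 1 + tsupport θ with hK
  have hKc : IsCompact K := (isCompact_closedBall _ _).add hθs
  have hsmall : ∀ᶠ n in atTop, (φ n).rOut ≤ 1 := (hφr.eventually (gt_mem_nhds one_pos)).mono fun n hn => hn.le
  have hsupp : ∀ n, (φ n).rOut ≤ 1 → ∀ {g : EuclideanSpace ℝ (Fin 3) → ℝ}, support g ⊆ tsupport θ →
      ∀ y, y ∉ K → ((φ n).normed volume ⋆[lsmul ℝ ℝ, volume] g) y = 0 := by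
    intro n hn g hg y hy
    apply notMem_support.1
    intro h
    have h' := support_convolution_subset_swap (L := lsmul ℝ ℝ) (μ := (volume : Measure (EuclideanSpace ℝ (Fin 3))))
      (f := (φ n).normed volume) (g := g) h
    rw [add_comm] at h'
    obtain ⟨a, ha, b, hb, rfl⟩ := h'
    apply hy
    refine ⟨a, ?_, b, hg hb, rfl⟩
    have := (φ n).support_normed_eq (μ := (volume : Measure (EuclideanSpace ℝ (Fin 3)))) ▸ ha
    rw [mem_ball_zero_iff] at this
    exact mem_closedBall_zero_iff.2 (this.le.trans hn)
  -- ### bounds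
  obtain ⟨Cθ, hCθ⟩ := hθc.bounded_above_of_compact_support hθs
  obtain ⟨CD, hCD⟩ := hDθc.bounded_above_of_compact_support (hθs.fderiv (𝕜 := ℝ))
  -- ### convergence of `∫ θn`
  have hlim0 : Tendsto (fun n => ∫ y, θn n y) atTop (𝓝 (∫ y, θ y)) := by
    refine tendsto_integral_filter_of_dominated_convergence (fun y => K.indicator (fun _ => Cθ) y) ?_ ?_
      ((integrable_indicator_iff hKc.measurableSet).2 (integrableOn_const hKc.measure_lt_top.ne)) ?_
    · exact Eventually.of_forall fun n => (hθn_t n).contDiff.continuous.aestronglyMeasurable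
    · filter_upwards [hsmall] with n hn
      refine Eventually.of_forall fun y => ?_
      by_cases hy : y ∈ K
      · rw [indicator_of_mem hy]; exact norm_normed_convolution_le (φ n) hCθ y
      · rw [indicator_of_notMem hy, hθn]
        dsimp only
        rw [hsupp n hn subset_closure y hy, norm_zero]
    · exact Eventually.of_forall fun y => ContDiffBump.convolution_tendsto_right_of_continuous hφr hθc y
  -- ### convergence of `∫ D(θn)[W]`
  have hlim1 : Tendsto (fun n => ∫ y, fderiv ℝ (θn n) y (W y)) atTop (𝓝 (∫ y, fderiv ℝ θ y (W y))) := by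
    have hWn : LocallyIntegrable (fun y => ‖W y‖) volume := fun z => (hWl z).norm
    refine tendsto_integral_filter_of_dominated_convergence (fun y => CD * (K.indicator (fun y => ‖W y‖) y)) ?_ ?_ ?_ ?_
    · refine Eventually.of_forall fun n => ?_
      exact Continuous.comp_aestronglyMeasurable₂ (g := fun (L : EuclideanSpace ℝ (Fin 3) →L[ℝ] ℝ) (v : EuclideanSpace ℝ (Fin 3)) => L v)
        (isBoundedBilinearMap_apply (𝕜 := ℝ) (E := EuclideanSpace ℝ (Fin 3)) (F := ℝ)).continuous
        ((hθn_s n).continuous_fderiv (by simp)).aestronglyMeasurable hWl.aestronglyMeasurable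
    · filter_upwards [hsmall] with n hn
      refine Eventually.of_forall fun y => ?_
      by_cases hy : y ∈ K
      · rw [indicator_of_mem hy, hθn, fderiv_normed_convolution_apply (φ n) hθ hθs]
        have hb : ∀ z, ‖fderiv ℝ θ z (W y)‖ ≤ CD * ‖W y‖ := fun z =>
          ((fderiv ℝ θ z).le_opNorm _).trans (mul_le_mul_of_nonneg_right (hCD z) (norm_nonneg _))
        exact norm_normed_convolution_le (φ n) hb y
      · have h0 : fderiv ℝ (θn n) y = 0 := by
          refine fderiv_of_notMem_tsupport ℝ ?_
          intro h
          -- `tsupport (θn n) ⊆ K` since `K` is closed and contains the support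
          have hKcl : IsClosed K := hKc.isClosed
          exact hy ((hKcl.closure_subset_iff.2 fun z hz => by
            by_contra hz'; exact hz (by rw [hθn]; exact hsupp n hn subset_closure z hz')) h)
        rw [h0, _root_.zero_apply, norm_zero, indicator_of_notMem hy, mul_zero]
    · exact ((integrable_indicator_iff hKc.measurableSet).2 ((hWl.integrableOn_isCompact hKc).norm)).const_mul CD
    · refine Eventually.of_forall fun y => ?_
      have e : (fun n => fderiv ℝ (θn n) y (W y)) =
          fun n => ((φ n).normed volume ⋆[lsmul ℝ ℝ, volume] fun z => fderiv ℝ θ z (W y)) y :=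
        funext fun n => by rw [hθn, fderiv_normed_convolution_apply (φ n) hθ hθs]
      rw [e]
      exact ContDiffBump.convolution_tendsto_right_of_continuous hφr (hDθc.clm_apply continuous_const) y
  -- ### conclusion
  have hlim1' : Tendsto (fun n => ∫ y, fderiv ℝ (θn n) y (W y)) atTop (𝓝 (-c * ∫ y, θ y)) := by
    have e : (fun n => ∫ y, fderiv ℝ (θn n) y (W y)) = fun n => -c * ∫ y, θn n y := funext hid
    rw [e]
    exact hlim0.const_mul (-c)
  exact tendsto_nhds_unique hlim1 hlim1'

end DivC1

/-! ### Local `L²` convergence of mollifications -/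

section L2loc

variable {F : Type*} [NormedAddCommGroup F] [NormedSpace ℝ F] [CompleteSpace F]

/-- **Local `L²` convergence of mollifications**: `g ∈ L²(B(0,r))` for every `r`; then along any bump sequence with `r_φₙ → 0`,
`∫_{B(0,M)} ‖φ̃ₙ ⋆ g − g‖² → 0` (the exponent-`2` twin of `WeakLagrangian.tendsto_setLIntegral_mollify_sub_rpow`). [folklore; Evans2010 App. C.4 Thm. 7 (iii)] -/
theorem tendsto_setLIntegral_mollify_sub_sq {φ : ℕ → ContDiffBump (0 : EuclideanSpace ℝ (Fin 3))}
    (hφ : Tendsto (fun n => (φ n).rOut) atTop (𝓝 0)) {g : EuclideanSpace ℝ (Fin 3) → F}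
    (hg : ∀ r : ℝ, MemLp g 2 (volume.restrict (ball (0 : EuclideanSpace ℝ (Fin 3)) r))) (M : ℝ) :
    Tendsto (fun n => ∫⁻ z in ball (0 : EuclideanSpace ℝ (Fin 3)) M, ‖((φ n).normed volume ⋆[lsmul ℝ ℝ, volume] g) z - g z‖ₑ ^ (2 : ℝ))
      atTop (𝓝 0) := by
  set ψ : EuclideanSpace ℝ (Fin 3) → F := (ball (0 : EuclideanSpace ℝ (Fin 3)) (M + 1)).indicator g with hψ
  have hψm : MemLp ψ 2 volume := by
    rw [hψ, memLp_indicator_iff_restrict measurableSet_ball]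
    exact hg (M + 1)
  have hconv := FunctionSpaces.tendsto_eLpNorm_normed_convolution_sub_self (μ := (volume : Measure (EuclideanSpace ℝ (Fin 3))))
    hφ one_le_two ENNReal.ofNat_ne_top hψm
  have hsmall : ∀ᶠ n in atTop, (φ n).rOut ≤ 1 := (hφ.eventually (gt_mem_nhds one_pos)).mono fun n hn => hn.le
  have hpow : Tendsto (fun n => eLpNorm ((φ n).normed volume ⋆[lsmul ℝ ℝ, volume] ψ - ψ) 2 volume ^ (2 : ℝ)) atTop (𝓝 0) := by
    have h0 : (0 : ℝ≥0∞) ^ (2 : ℝ) = 0 := ENNReal.zero_rpow_of_pos (by norm_num)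
    rw [← h0]
    exact (ENNReal.continuous_rpow_const.tendsto 0).comp hconv
  refine tendsto_of_tendsto_of_tendsto_of_le_of_le' tendsto_const_nhds hpow (Eventually.of_forall fun n => bot_le) ?_
  filter_upwards [hsmall] with n hn
  have heq : ∀ z ∈ ball (0 : EuclideanSpace ℝ (Fin 3)) M,
      ‖((φ n).normed volume ⋆[lsmul ℝ ℝ, volume] g) z - g z‖ₑ ^ (2 : ℝ) =
        ‖((φ n).normed volume ⋆[lsmul ℝ ℝ, volume] ψ - ψ) z‖ₑ ^ (2 : ℝ) := by
    intro z hz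
    have hzM : z ∈ ball (0 : EuclideanSpace ℝ (Fin 3)) (M + 1) := ball_subset_ball (by linarith) hz
    have hsub : ball z (φ n).rOut ⊆ ball (0 : EuclideanSpace ℝ (Fin 3)) (M + 1) := by
      intro t ht
      rw [mem_ball, dist_zero_right]
      rw [mem_ball, dist_eq_norm] at ht
      rw [mem_ball, dist_zero_right] at hz
      calc ‖t‖ = ‖(t - z) + z‖ := by rw [sub_add_cancel]
        _ ≤ ‖t - z‖ + ‖z‖ := norm_add_le _ _
        _ < M + 1 := by linarith
    rw [Pi.sub_apply, hψ, WeakLagrangian.normed_convolution_indicator_eq (φ n) hsub, indicator_of_mem hzM]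
  rw [setLIntegral_congr_fun measurableSet_ball heq]
  calc ∫⁻ z in ball (0 : EuclideanSpace ℝ (Fin 3)) M, ‖((φ n).normed volume ⋆[lsmul ℝ ℝ, volume] ψ - ψ) z‖ₑ ^ (2 : ℝ)
      ≤ ∫⁻ z, ‖((φ n).normed volume ⋆[lsmul ℝ ℝ, volume] ψ - ψ) z‖ₑ ^ (2 : ℝ) := setLIntegral_le_lintegral _ _
    _ = eLpNorm ((φ n).normed volume ⋆[lsmul ℝ ℝ, volume] ψ - ψ) 2 volume ^ (2 : ℝ) := by
        rw [eLpNorm_eq_lintegral_rpow_enorm_toReal (by norm_num) ENNReal.ofNat_ne_top, ENNReal.toReal_ofNat, ← ENNReal.rpow_mul]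
        norm_num

end L2loc

end Summit.NavierStokesRegularity.NavierStokesRegularity.Theorems.PowerGaugeEulerLiouville.WeakAxisym

end
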